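import Summits.HubbardSuperconductivity.HubbardSuperconductivity.Theses.ChiralWindow
import Summits.HubbardSuperconductivity.HubbardSuperconductivity.Theses.KacWindowPenalty
import Summits.HubbardSuperconductivity.HubbardSuperconductivity.Theorems.WcbcsSsbToTorusLRO.Negative.FacePurityDissection
import Summits.HubbardSuperconductivity.HubbardSuperconductivity.Theorems.WcbcsSsbToTorusLRO.Negative.WindowInfraredBound1089
import Literature.MathematicalPhysics.QuantumLattice.DWaveSource
import Literature.MathematicalPhysics.QuantumLattice.HubbardGrandCanonicalDensity
import Summits.HubbardSuperconductivity.HubbardSuperconductivity.Theorems.ChiralWindowCwSsbToEvenTorusLROBlockSlope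
import Summits.HubbardSuperconductivity.HubbardSuperconductivity.Theorems.ChiralWindowCwSsbToEvenTorusLROSourceRemoval
import Summits.HubbardSuperconductivity.HubbardSuperconductivity.Theorems.ChiralWindowCwSsbToEvenTorusLROSectorFloorGC
import Summits.HubbardSuperconductivity.HubbardSuperconductivity.Theorems.ChiralWindowCwSsbToEvenTorusLROCanonicalSupportingPotential
import Summits.HubbardSuperconductivity.HubbardSuperconductivity.Theorems.ChiralWindowCwSsbToEvenTorusLROAttractiveChordFloor
import Summits.HubbardSuperconductivity.HubbardSuperconductivity.Theorems.AposterioriCapRgSsbToEvenTorusLroFacePurityOfGcRepelledChord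
import Summits.HubbardSuperconductivity.HubbardSuperconductivity.Theorems.ChiralWindowCwSsbToEvenTorusLROSlopeGlue
import Summits.HubbardSuperconductivity.HubbardSuperconductivity.Theorems.ChiralWindowCwSsbToEvenTorusLRONoKinkGlue

/-!
# Line `griffiths-block-slope` — lead prover's checked skeleton, v4.2 (v4 RESHAPED; v4.1: S6 LANDED p99547; v4.2: the whole composition + dichotomy LANDED p100695/p102590 and imported — this file is now the two open stubs + the skeleton theorem; the open core is now the SOURCE-FREE
block-slope floor S2'; the sourced Transfer-B stub S2 of v3 is a sufficient SUPPLIER of S2', proved here; new provable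
stub S6 `stub_attractiveChordFloor` consumes `HasDWaveOrder`) for crux `CwSsbToEvenTorusLRO`
(stmt-HubbardSuperconductivity-10439, route `ChiralWindow`; `Iff.rfl`-twin of `WeakCouplingBCS.WcbcsSsbToTorusLRO`,
stmt-2009). Lead: prover-line-stmt-HubbardSuperconductivity-10439-c1-0, 2026-08-16 (continuing
prover-line-stmt-HubbardSuperconductivity-10439-0's v3, tree `Lines/griffiths_block_slope.lean` @de3141b7d518).

Crux: `∃ U₀ > 0, ∀ U ∈ Ioo 0 U₀, ∀ δ ∈ Ioo 0 (1/2), ∀ μ, DensityMatched U δ μ → HasDWaveOrder U μ → (summit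
matrix at (U, δ))`.

Notation. `K_μ = hubbardTorusWith 2 L 1 U μ` (grand-canonical, SOURCE-FREE), `T_h = dWaveSourceTorus L U μ h =
K_μ − h(P + Pᴴ)`, `P = pairField dWaveFormFactor L`, `W_R = R⁻⁴ Σ_a B_aᴴ B_a`, `B_a = Σ_{u ∈ [0,R)²} P_{a+u}` (Fejér
convention of the twin's landed files), `E₀ = Matrix.groundEnergy`, `m = dWaveOrderParameter U μ`.

WHY v4 (the lead's dissection of v3). Write `g(h, κ) = E₀(T_h + κ W_R)` (jointly concave, finite `L`). The composition of
v3 consumed S2 (sourced repelled order at FIXED `κ > 0` for ALL small `h`) only to produce, through S1 (sourced chord) and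
S4 (two Weyl source removals, cost `24hL²`, hence `h ≪ κ`), the SOURCE-FREE repulsive chord
`g(0, κ) − g(0, 0) ≥ κ a L²` — and that chord ALONE, with S5 (GC floor under the sector energy) and the canonical/GC
equivalence at the crux's own `μ` (landed S3 = stmt-9491 + density matching, Griffiths recentring), gives the CHORD form
of face purity, whence the crux via the twin's landed dissection + Fejér closure + the pointwise infrared leak (item
stmt-1089). So the honest open core of this line is

  S2' `stub_sourceFreeBlockSlopeFloor`: under the crux hypotheses at `(U, μ)`, one floor `a > 0` such that for every
  block scale `R ≥ 1` some `κ = κ(R) > 0` has, eventually along the even sides `L = 2k+2`,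
  `E₀(K_μ + κ W_R) − E₀(K_μ) ≥ κ a L²`

(the right chord of the concave `κ ↦ E₀(K_μ + κW_R)` at `0`: every GC ground state of every slightly block-REPELLED
source-free torus keeps block `d`-wave order `≥ a` at scale `R`). It is STRICTLY WEAKER than S2 (`slopeFloor_of_repelledOrderAt`:
S2 ⇒ S2', sorry-free, from the landed S1/S4), has no source, no `h`-uniformity, and is the natural OUTPUT TYPE of a
construction (a difference of two ground-state energy DENSITIES of `U(1)`-invariant finite-range Hamiltonians, resolved to
`κ·a`). The left chord is a THEOREM: S6 `stub_attractiveChordFloor` (provable now from S1 at `κ = 0`, S4 and the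
staircase lever `dWaveOrderParameter_le_liminf`): `E₀(K_μ) − E₀(K_μ − tW_R) ≥ t(m² − ε)L²` eventually, for every
`t ≥ 0`, `R ≥ 1` — Koma–Tasaki order forces the ATTRACTIVE block slope `≥ m²`. Hence the crux's thermodynamic content on
this line is exactly "the block slope does not COLLAPSE across `κ = 0`": `slopeFloor_of_noCollapse` (right chord `≥ θ ×`
left chord for some `θ > 0` ⇒ S2' with `a = θ m²/2`, sorry-free from S6 + `HasDWaveOrder`). A first-order coexistence at
the density-matched `μ` with a block-POORER competitor (Disproof §3/§6d) is the one configuration where it collapses.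

* S2' `stub_sourceFreeBlockSlopeFloor` — OPEN (the line; held by the lead; `promote`-grade).
* S6  `stub_attractiveChordFloor` — LANDED p99547 (worker of lead c1), imported.
* S1 `stub_blockSlope` p78752, S3 `stub_canonicalSupportingPotential` p85009 (= stmt-9491, closed p85877), S4
  `stub_sourceRemoval` p80687, S5 `stub_sectorFloorGC` p82337 — LANDED (v3), imported.
* COMPOSITION (sorry-free): `chord_of_slopeFloorAt` (S2'-body + DM ⇒ CHORD(U, δ), via S5 + CGE), then VERBATIM the
  twin's landed `deriv_of_chord` → `floor_of_deriv_of_leak` (pointwise leak = what stmt-1089 gives, `leak_of_windowInfraredBound`)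
  → `hasDWavePairFieldLROAt_of_floor`; `CwSsbToEvenTorusLRO_of` concludes the crux BY NAME from S2' + stmt-1089 by name.
  Kept from v3 (now factored through S2'): `CwSsbToEvenTorusLRO_of_repelledOrderPersistence`, and the route-level
  corollaries `CwThesis_of_slopeConstruction` / `CwThesis_of_repelledConstruction` (the transfer dissolved into a
  robustness clause of the construction crux: {clause, stmt-1089} ⊢ `CwThesis`, no `CwGlue`).

Disproof used (`Cruxes/CwSsbToEvenTorusLRO/Disproof.lean`, gen 3): §1 (no `_false_without_`; both hypotheses are consumed —
DM in the recentring, `HasDWaveOrder` in S6 / as S2'-guard); §2 (`_of` concludes the crux BY NAME; every lemma is pointwise in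
`(U, δ, μ)`, so `TransferOnWindow` remains available); §3/§6d (kill configuration = SC/normal equal-density coexistence: it is
where the right chord collapses while S6 keeps the left one — `transferB_fails_at_scNormal_coexistence`); §4b/§4c (S2' is the
`κ = 0⁺` right-slope floor of the concave block energy — weaker than `NoBlockKink`, which asks right slope = left slope;
`coexistence_defeats_encoding`); §5 (`hasDerivAt_toyBlock`: at mean field the slope is exactly `m²` on both sides, S2' holds
with `a = m²`); §6 (S1/S4/S5 proved verbatim — landed; κ-ceiling `repelled_pairDensity_lt_of_large_coupling` respected: S2'
has `∀R ∃κ(R)`, never `∀κ`).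
-/

noncomputable section

set_option linter.dupNamespace false

namespace Summit.HubbardSuperconductivity.HubbardSuperconductivity.Cruxes.CwSsbToEvenTorusLRO.GriffithsBlockSlope

open Literature.MathematicalPhysics.QuantumLattice Literature.Barriers.HubbardSuperconductivity
open Summit.HubbardSuperconductivity.WcbcsSsbToTorusLRO.Negative
open Summit.HubbardSuperconductivity.HubbardSuperconductivity.Theorems.CwSsbToEvenTorusLRO
  (stub_blockSlope stub_sourceRemoval stub_sectorFloorGC stub_canonicalSupportingPotential stub_attractiveChordFloor
    hasDWavePairFieldLROAt_of_slopeFloorAt slopeFloor_of_noCollapseAt slopeFloor_of_noBlockKinkAt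
    cwSsbToEvenTorusLRO_of_sourceFreeBlockSlopeFloor cwSsbToEvenTorusLRO_of_repelledOrderPersistence
    cwSsbToEvenTorusLRO_of_noBlockKink cwSsbToEvenTorusLRO_of_noSlopeCollapse
    cwThesis_of_slopeConstruction cwThesis_of_repelledConstruction)
open Summit.HubbardSuperconductivity.HubbardSuperconductivity.Theorems
  (gcRepelledChord_of_repelledOrderAt fp_chord_of_gcRepelledChordAt)
open Filter Set Matrix
open scoped Matrix ComplexOrder BigOperators
open _root_.Topology

/-! ## The registered stubs (v4) -/

/-- **Stub S2' — source-free block-slope floor (OPEN, the line's core; held by the lead).** Under the crux hypotheses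
at `(U, δ, μ)`: one floor `a > 0` such that for every block scale `R ≥ 1` some repulsive block coupling `κ = κ(R) > 0`
raises the SOURCE-FREE grand-canonical ground energy at rate at least `a` per site, eventually along the even sides:
`E₀(K_μ + κ W_R) − E₀(K_μ) ≥ κ a (2k+2)²`. Equivalently (Danskin): every ground state of every `K_μ + κ'W_R`,
`0 < κ' ≤ κ`, has block `d`-wave order `≥ a` at scale `R`. Weaker than v3's S2 (`slopeFloor_of_repelledOrderAt`). -/
theorem stub_sourceFreeBlockSlopeFloor :
    ∃ U₀ : ℝ, 0 < U₀ ∧ ∀ U ∈ Set.Ioo (0:ℝ) U₀, ∀ δ ∈ Set.Ioo (0:ℝ) (1 / 2), ∀ μ : ℝ, Filter.Tendsto (fun L : ℕ => ((hubbardTorusWith 2 (L + 1) 1 U μ).groundStateFunctional totalNumber).re / ((L + 1 : ℕ) : ℝ) ^ 2) Filter.atTop (nhds (1 - δ)) → HasDWaveOrder U μ → ∃ a : ℝ, 0 < a ∧ ∀ R : ℕ, 0 < R → ∃ κ : ℝ, 0 < κ ∧ ∀ᶠ k : ℕ in Filter.atTop, κ * a * ((2 * k + 1 + 1 : ℕ)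 : ℝ) ^ 2 ≤ (hubbardTorusWith 2 (2 * k + 1 + 1) 1 U μ + (κ : ℂ) • (((((R : ℝ) ^ 4)⁻¹ : ℝ) : ℂ) • ∑ a : Literature.Probability.LatticeModels.TorusSite 2 (2 * k + 1 + 1), (∑ u : Fin 2 → Fin R, localPair dWaveFormFactor (2 * k + 1 + 1) (a + fun i => ((u i : ℕ) : ZMod (2 * k + 1 + 1))))ᴴ * (∑ u : Fin 2 → Fin R, localPair dWaveFormFactor (2 * k + 1 + 1) (a + fun i => ((u i : ℕ) : ZMod (2 * k + 1 + 1)))))).groundEnergy - (hubbardTorusWith 2 (2 * k + 1 + 1) 1 U μ).groundEnergy := by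
  sorry

-- Stub S6 `stub_attractiveChordFloor` LANDED (p99547, Theorems/ChiralWindowCwSsbToEvenTorusLROAttractiveChordFloor.lean; worker of lead c1) — imported and opened above.

/-- **Stub S7 — weak-coupling infrared leak (OPEN; = the planner's original `stub_infraredLeak`, guarded and pointwise;
supplied by item stmt-HubbardSuperconductivity-1089 `KacWindowPenalty.WindowInfraredBound` through
`infraredLeak_of_windowInfraredBound` below, but strictly weaker than it: only `U < U₀`, only under the crux hypotheses).**
For every budget `b > 0` a momentum radius `η > 0` such that, eventually along the even sides, every normalised sector
ground state carries `d`-wave pair structure factor at most `b L²` in total on the nonzero momenta of norm `< η`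
(no macroscopic pair weight at small NONZERO momenta: no pair-density wave, no soft texture). -/
theorem stub_infraredLeak :
    ∃ U₀ : ℝ, 0 < U₀ ∧ ∀ U ∈ Set.Ioo (0:ℝ) U₀, ∀ δ ∈ Set.Ioo (0:ℝ) (1 / 2), ∀ μ : ℝ, Filter.Tendsto (fun L : ℕ => ((hubbardTorusWith 2 (L + 1) 1 U μ).groundStateFunctional totalNumber).re / ((L + 1 : ℕ) : ℝ) ^ 2) Filter.atTop (nhds (1 - δ)) → HasDWaveOrder U μ → ∀ b : ℝ, 0 < b → ∃ η : ℝ, 0 < η ∧ ∀ᶠ k : ℕ in Filter.atTop, ∀ ψ : Fock (Orb (FermionTorus 2 (2 * k + 1 + 1))), IsGroundStateInSector (hubbardTorus 2 (2 * k + 1 + 1) 1 U) (2 * ⌊(1 - δ) * ((2 * k + 1 + 1 : ℕ) : ℝ) ^ 2 / 2⌋₊) 0 ψ → star ψ ⬝ᵥ ψ = 1 → (∑ m ∈ (Finset.univ.filter fun m : Literature.Probability.LatticeModels.TorusSite 2 (2 * k + 1 + 1) => m ≠ 0 ∧ momentumNormSq (2 * k + 1 + 1) m < η ^ 2), pairStructureFactor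 dWaveFormFactor (2 * k + 1 + 1) ψ m) / ((2 * k + 1 + 1 : ℕ) : ℝ) ^ 2 ≤ b := by
  sorry

-- Stubs S1 `stub_blockSlope` (p78752), S3 `stub_canonicalSupportingPotential` (p85009), S4 `stub_sourceRemoval` (p80687),
-- S5 `stub_sectorFloorGC` (p82337): LANDED under `Theorems/ChiralWindowCwSsbToEvenTorusLRO*.lean` — imported and opened above.

/-! ## LANDED composition (imported; this seat): Theorems/ChiralWindowCwSsbToEvenTorusLROSlopeGlue.lean (p100695) —
`hasDWavePairFieldLROAt_of_slopeFloorAt` (S2' + DM + pointwise leak ⇒ matrix; over the sibling lead's landed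
`gcRepelledChord_of_repelledOrderAt` = S2 ⇒ S2' and `fp_chord_of_gcRepelledChordAt` = S2' + DM ⇒ CHORD, and the twin's `deriv_of_chord` /
`floor_of_deriv_of_leak` / `hasDWavePairFieldLROAt_of_floor`), the conditional glue `cwSsbToEvenTorusLRO_of_sourceFreeBlockSlopeFloor` (REGISTERED
obligation: crux ⇐ S2' ∧ stmt-1089), `cwSsbToEvenTorusLRO_of_repelledOrderPersistence` (crux ⇐ S2 ∧ stmt-1089) and the route-level
`cwThesis_of_slopeConstruction` / `cwThesis_of_repelledConstruction`; Theorems/ChiralWindowCwSsbToEvenTorusLRONoKinkGlue.lean (p102590) —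
the DICHOTOMY over the landed S6: `slopeFloor_of_noCollapseAt`, `slopeFloor_of_noBlockKinkAt` (no-collapse / no-kink ⇒ S2'),
`cwSsbToEvenTorusLRO_of_noBlockKink` (REGISTERED obligation: crux ⇐ NoBlockKink ∧ stmt-1089), `cwSsbToEvenTorusLRO_of_noSlopeCollapse`. -/

/-! ## Item stmt-1089 supplies S7 -/

/-- **stmt-1089 ⇒ S7 (sorry-free).** The route item `KacWindowPenalty.WindowInfraredBound` (stmt-HubbardSuperconductivity-1089,
`∀ U > 0`, `∀ δ ∈ (0, 1/2)`, Σ-form) gives the guarded weak-coupling leak S7 with `U₀ := 1` (any value) — the twin's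
landed `leak_of_windowInfraredBound`; the guard is not used. -/
theorem infraredLeak_of_windowInfraredBound
    (hW : Summit.HubbardSuperconductivity.HubbardSuperconductivity.Theses.KacWindowPenalty.WindowInfraredBound) :
    ∃ U₀ : ℝ, 0 < U₀ ∧ ∀ U ∈ Set.Ioo (0:ℝ) U₀, ∀ δ ∈ Set.Ioo (0:ℝ) (1 / 2), ∀ μ : ℝ, Filter.Tendsto (fun L : ℕ => ((hubbardTorusWith 2 (L + 1) 1 U μ).groundStateFunctional totalNumber).re / ((L + 1 : ℕ) : ℝ) ^ 2) Filter.atTop (nhds (1 - δ)) → HasDWaveOrder U μ → ∀ b : ℝ, 0 < b → ∃ η : ℝ, 0 < η ∧ ∀ᶠ k : ℕ in Filter.atTop, ∀ ψ : Fock (Orb (FermionTorus 2 (2 * k + 1 + 1))), IsGroundStateInSector (hubbardTorus 2 (2 * k + 1 + 1) 1 U) (2 * ⌊(1 - δ) * ((2 * k + 1 + 1 : ℕ) : ℝ) ^ 2 / 2⌋₊) 0 ψ → star ψ ⬝ᵥ ψ = 1 → (∑ m ∈ (Finset.univ.filter fun m : Literature.Probability.LatticeModels.TorusSite 2 (2 *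 k + 1 + 1) => m ≠ 0 ∧ momentumNormSq (2 * k + 1 + 1) m < η ^ 2), pairStructureFactor dWaveFormFactor (2 * k + 1 + 1) ψ m) / ((2 * k + 1 + 1 : ℕ) : ℝ) ^ 2 ≤ b :=
  ⟨1, one_pos, fun _U hU _δ hδ _μ _ _ => leak_of_windowInfraredBound hW hU.1 hδ⟩

/-! ## The skeleton theorem (placed FIRST among the theorems concluding the crux: the gate's skeleton check takes the
first such theorem; it has NO hypotheses — every input is a registered stub or a landed theorem) -/

/-- **The skeleton theorem (v4).** The open stubs `stub_sourceFreeBlockSlopeFloor` (S2', thermodynamic core) and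
`stub_infraredLeak` (S7, infrared core; supplied by item stmt-1089 via `infraredLeak_of_windowInfraredBound`), with the
landed S3/S5 and the twin's landed dissection/Fejér/kernel files, conclude the crux `CwSsbToEvenTorusLRO` BY NAME
(`U₀ :=` the minimum of the two thresholds). S6 enters through the alternative glue `CwSsbToEvenTorusLRO_of_noSlopeCollapse`. -/
theorem CwSsbToEvenTorusLRO_of :
    Summit.HubbardSuperconductivity.HubbardSuperconductivity.Theses.ChiralWindow.CwSsbToEvenTorusLRO := by
  obtain ⟨U₁, hU₁, hS⟩ := stub_sourceFreeBlockSlopeFloor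
  obtain ⟨U₂, hU₂, hIR⟩ := stub_infraredLeak
  refine ⟨min U₁ U₂, lt_min hU₁ hU₂, fun U hU δ hδ μ hdm hord => ?_⟩
  have hU1 : U ∈ Set.Ioo (0:ℝ) U₁ := ⟨hU.1, lt_of_lt_of_le hU.2 (min_le_left _ _)⟩
  have hU2 : U ∈ Set.Ioo (0:ℝ) U₂ := ⟨hU.1, lt_of_lt_of_le hU.2 (min_le_right _ _)⟩
  exact hasDWavePairFieldLROAt_of_slopeFloorAt hδ hdm (hS U hU1 δ hδ μ hdm hord) (hIR U hU2 δ hδ μ hdm hord)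

end Summit.HubbardSuperconductivity.HubbardSuperconductivity.Cruxes.CwSsbToEvenTorusLRO.GriffithsBlockSlope

end
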